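import Mathlib.RingTheory.MvPolynomial.Symmetric.FundamentalTheorem
import Mathlib.Algebra.Polynomial.Lifts
import Literature.NumberTheory.GaloisRepresentations.WeakAbelianDirectSummand
import Literature.NumberTheory.GaloisRepresentations.ArtinRestriction
import Literature.NumberTheory.GaloisRepresentations.FrobeniusDensityTheorem
import Literature.NumberTheory.GaloisRepresentations.WeakAbelianDirectSummandRestrictProofs
import Literature.NumberTheory.Automorphic.ReciprocityGLnRestrictionProofs
import HarnessLib

/-!
# `E`-rationality is stable under restriction to a finite extension (proofs)

Topic `NumberTheory/GaloisRepresentations`; namespace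
`Literature.NumberTheory.GaloisRepresentations`.  A *proofs* file (theorems only; no definition,
no named fact), sibling of `WeakAbelianDirectSummand.lean` (Böckle–Hui 2025: `E`-rationality
`FramedGaloisRep.IsRationalOver`, BH §2.1; the named fact
`exists_heckeCharacter_of_weaklyDivides` = Thm. 1.1) and of
`WeakAbelianDirectSummandRestrictProofs.lean` (`WeaklyDivides.restrictField`).

The printed proof of Theorem 1.1 opens (BH §2.7, p. 9): "For any finite field extension `L/K`,
the restriction `ρ_ℓ|_{Gal_L}` is also `E`-rational. Since the local algebraicity of `ψ_ℓ`
follows from the local algebraicity of `ψ_ℓ|_{Gal_L}`, we may assume that the algebraic monodromy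
group `G_ℓ` is connected by replacing `K` by some finite extension."  The first sentence is proved
here, in every rank `n` and over any coefficient field `k` (for BH, `k = ℚ̄_ℓ`):

* `isSymmetric_aeval_X_pow_esymm`, `Multiset.esymm_map_pow_mem` — **symmetric functions of
  powers**: if all elementary symmetric functions `e_j(s)` of a multiset `s` lie in a subring
  `T`, then so do all `e_m(s^{(f)})`, `s^{(f)} = {a^f : a ∈ s}` (the symmetric polynomial
  `e_m(X_1^f, …, X_n^f) ∈ ℤ[X]^{𝔖_n}` is an integer polynomial in `e_1, …, e_n`: fundamental
  theorem of symmetric polynomials, Mathlib `MvPolynomial.esymmAlgEquiv`).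
* `exists_prod_X_sub_C_pow_eq_map` — hence if `∏_{a ∈ s} (X - a) = P^e` for a `P ∈ E[X]` and a
  ring map `e : E → L`, then `∏_{a ∈ s} (X - a^f) = Q^e` for some `Q ∈ E[X]` (Vieta,
  `Multiset.prod_X_sub_C_coeff`; `Polynomial.lifts_iff_coeff_lifts`).
* `Matrix.exists_charpoly_pow_eq_map` — for a matrix `M` over a field `k` with `χ_M = P^e`,
  `χ_{M^f} = Q^e` with `Q ∈ E[X]` depending only on `P`, `e`, `f` (pass to `k̄`, where
  `χ_{M^f} = ∏ (X - a^f)` over the roots `a` of `χ_M`: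
  `Literature.NumberTheory.Automorphic.Matrix.charpoly_pow_eq_prod_of_charpoly_eq_prod`).
* **`FramedGaloisRep.IsRationalOver.restrictField`** — if `σ : Γ_K →ₜ* GL_n(k)` is `E`-rational
  (`IsRationalOver e`), so is `σ|_{Γ_L}` for every finite extension `L/K` of number fields: above
  the cofinitely many good `v` lie cofinitely many `w` (`finite_setOf_under_eq`), `σ|_{Γ_L}` is
  unramified at them (`FramedGaloisRep.isUnramifiedAt_restrictField`), and an arithmetic Frobenius
  at `w` acts as `Frob_v^{f(w|v)}` (`FramedGaloisRep.exists_restrictField_apply_eq_pow`), whose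
  characteristic polynomial is `Q^e`.

## References

* G. Böckle, C.-Y. Hui, *Weak abelian direct summands and irreducibility of Galois
  representations*, Math. Ann. 393 (2025), §2.1 and §2.7 (proof of Thm. 1.1, first sentence).
  [BockleHui2025]
* J.-P. Serre, *Abelian ℓ-adic representations and elliptic curves* (1968), Ch. I §2.3
  (rational representations; remark on restriction). [SerreAbelianLadic1968]
* N. Bourbaki, *Algèbre*, Ch. IV §6, no. 1, Thm. 1 (fundamental theorem of symmetric
  polynomials). [folklore]
-/

noncomputable section

open Polynomial Filter IsDedekindDomain NumberField

namespace Literature.NumberTheory.GaloisRepresentations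

/-! ### Symmetric functions of powers -/

section Symmetric

/-- The polynomial `e_m(X_1^f, …, X_n^f) ∈ ℤ[X_1, …, X_n]` is symmetric. [folklore] -/
theorem isSymmetric_aeval_X_pow_esymm (n f m : ℕ) :
    (MvPolynomial.aeval (fun i : Fin n => (MvPolynomial.X i : MvPolynomial (Fin n) ℤ) ^ f)
      (MvPolynomial.esymm (Fin n) ℤ m)).IsSymmetric := by
  intro σ
  have h1 : (MvPolynomial.rename (σ : Fin n → Fin n)).comp
      (MvPolynomial.aeval fun i : Fin n => (MvPolynomial.X i : MvPolynomial (Fin n) ℤ) ^ f) =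
      MvPolynomial.aeval
        ((fun i : Fin n => (MvPolynomial.X i : MvPolynomial (Fin n) ℤ) ^ f) ∘ (σ : Fin n → Fin n)) := by
    rw [MvPolynomial.comp_aeval]
    congr 1
    funext i
    simp only [Function.comp_apply, map_pow, MvPolynomial.rename_X]
  have h2 := congrArg (fun φ => φ (MvPolynomial.esymm (Fin n) ℤ m)) h1
  simp only [AlgHom.comp_apply] at h2
  rw [h2, ← MvPolynomial.aeval_rename, MvPolynomial.rename_esymm]

/-- **Symmetric functions of powers.**  If all elementary symmetric functions `e_j(s)`,
`j ≤ |s|`, of a multiset `s` of elements of a commutative ring lie in a subring `T`, then so does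
every elementary symmetric function of the multiset `{a^f : a ∈ s}` of `f`-th powers: the
symmetric polynomial `e_m(X_1^f, …, X_n^f)` is an integer polynomial in `e_1, …, e_n`
(fundamental theorem of symmetric polynomials, Mathlib `MvPolynomial.esymmAlgEquiv`), evaluated
at an enumeration of `s`.  Bourbaki, *Algèbre*, Ch. IV §6, no. 1, Thm. 1. [folklore] -/
theorem Multiset.esymm_map_pow_mem {L : Type*} [CommRing L] (T : Subring L) (s : Multiset L)
    (hs : ∀ j ≤ Multiset.card s, s.esymm j ∈ T) (f m : ℕ) : (s.map (· ^ f)).esymm m ∈ T := by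
  classical
  set l := s.toList with hl
  have hM : (Finset.univ.val.map l.get : Multiset L) = s := by
    rw [Fin.univ_val_map, List.ofFn_get, Multiset.coe_toList]
  have hn : l.length = Multiset.card s := Multiset.length_toList s
  -- the symmetric polynomial `e_m(X_i^f)` and its expression `Rm` in the `e_j`
  set Sm : MvPolynomial (Fin l.length) ℤ :=
    MvPolynomial.aeval
      (fun i : Fin l.length => (MvPolynomial.X i : MvPolynomial (Fin l.length) ℤ) ^ f)
      (MvPolynomial.esymm (Fin l.length) ℤ m) with hSm
  have hsymm : Sm.IsSymmetric := isSymmetric_aeval_X_pow_esymm l.length f m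
  set Rm : MvPolynomial (Fin l.length) ℤ :=
    (MvPolynomial.esymmAlgEquiv (Fin l.length) ℤ (Fintype.card_fin l.length)).symm ⟨Sm, hsymm⟩
    with hRm
  have hRS : MvPolynomial.aeval
      (fun i : Fin l.length => MvPolynomial.esymm (Fin l.length) ℤ (i + 1)) Rm = Sm := by
    have h1 : MvPolynomial.esymmAlgEquiv (Fin l.length) ℤ (Fintype.card_fin l.length) Rm =
        ⟨Sm, hsymm⟩ :=
      AlgEquiv.apply_symm_apply _ _
    have h2 := congrArg Subtype.val h1
    rw [MvPolynomial.esymmAlgEquiv_apply, MvPolynomial.esymmAlgHom_apply] at h2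
    exact h2
  -- evaluate at the enumeration `l.get` of `s`
  have hev1 : MvPolynomial.aeval l.get Sm = (s.map (· ^ f)).esymm m := by
    rw [hSm, ← AlgHom.comp_apply, MvPolynomial.comp_aeval]
    simp only [map_pow, MvPolynomial.aeval_X]
    rw [MvPolynomial.aeval_esymm_eq_multiset_esymm, ← hM, Multiset.map_map]
    rfl
  have hev2 : MvPolynomial.aeval l.get Sm =
      MvPolynomial.aeval (fun i : Fin l.length => s.esymm (i + 1)) Rm := by
    have hfun : (fun i : Fin l.length =>
        MvPolynomial.aeval l.get (MvPolynomial.esymm (Fin l.length) ℤ (i + 1))) =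
        fun i : Fin l.length => s.esymm (i + 1) := by
      funext i
      rw [MvPolynomial.aeval_esymm_eq_multiset_esymm, hM]
    rw [← hRS, ← AlgHom.comp_apply, MvPolynomial.comp_aeval, hfun]
  rw [← hev1, hev2]
  -- all arguments lie in `T`, hence so does the value of the integer polynomial `Rm`
  have hx : ∀ i : Fin l.length, s.esymm (i + 1) ∈ subalgebraOfSubring T := fun i => by
    rw [mem_subalgebraOfSubring]
    exact hs _ (by omega)
  have hcoe := Subalgebra.mvPolynomial_aeval_coe (subalgebraOfSubring T)
    (fun i : Fin l.length => (⟨s.esymm (i + 1), hx i⟩ : subalgebraOfSubring T)) Rm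
  rw [show (fun i : Fin l.length => s.esymm ((i : ℕ) + 1)) =
      fun i : Fin l.length => ((⟨s.esymm (i + 1), hx i⟩ : subalgebraOfSubring T) : L) from rfl,
    hcoe]
  exact mem_subalgebraOfSubring.mp (Subtype.mem _)

/-- **Descent of `∏ (X - a^f)`.**  If `∏_{a ∈ s} (X - a) = P^e` is the image of a polynomial
`P ∈ E[X]` under a ring map `e : E → L`, then for every `f`, `∏_{a ∈ s} (X - a^f) = Q^e` for some
`Q ∈ E[X]`: by Vieta (`Multiset.prod_X_sub_C_coeff`) the `e_j(s)` lie in the subring `e(E)`,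
hence so do the `e_m(a^f : a ∈ s)` (`Multiset.esymm_map_pow_mem`), which are up to sign the
coefficients of `∏ (X - a^f)`. [folklore] -/
theorem exists_prod_X_sub_C_pow_eq_map {E L : Type*} [CommRing E] [CommRing L] (e : E →+* L)
    {s : Multiset L} {P : E[X]} (h : (s.map fun a => X - C a).prod = P.map e) (f : ℕ) :
    ∃ Q : E[X], (s.map fun a => X - C (a ^ f)).prod = Q.map e := by
  rcases subsingleton_or_nontrivial L with hL | hL
  · exact ⟨0, Subsingleton.elim _ _⟩
  have hs : ∀ j ≤ Multiset.card s, s.esymm j ∈ e.range := by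
    intro j hj
    have hc := Multiset.prod_X_sub_C_coeff s (Nat.sub_le (Multiset.card s) j)
    rw [Nat.sub_sub_self hj, h, Polynomial.coeff_map] at hc
    have hsj : s.esymm j = (-1) ^ j * e (P.coeff (Multiset.card s - j)) := by
      rw [hc, ← mul_assoc, ← mul_pow, neg_mul_neg, one_mul, one_pow, one_mul]
    rw [hsj]
    exact e.range.mul_mem (e.range.pow_mem (e.range.neg_mem e.range.one_mem) _) ⟨_, rfl⟩
  have hT := fun m => Multiset.esymm_map_pow_mem e.range s hs f m
  have hprod : (s.map fun a => X - C (a ^ f)).prod =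
      ((s.map (· ^ f)).map fun a => X - C a).prod := by
    rw [Multiset.map_map]
    rfl
  rw [hprod]
  have hlift : ((s.map (· ^ f)).map fun a => X - C a).prod ∈ Polynomial.lifts e := by
    rw [Polynomial.lifts_iff_coeff_lifts]
    intro k
    by_cases hk : k ≤ Multiset.card (s.map (· ^ f))
    · rw [Multiset.prod_X_sub_C_coeff _ hk]
      exact RingHom.mem_range.mp
        (e.range.mul_mem (e.range.pow_mem (e.range.neg_mem e.range.one_mem) _) (hT _))
    · rw [Polynomial.coeff_eq_zero_of_natDegree_lt]
      · exact ⟨0, map_zero e⟩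
      · rw [Polynomial.natDegree_multiset_prod_X_sub_C_eq_card]
        exact lt_of_not_ge hk
  obtain ⟨Q, hQ⟩ := (Polynomial.mem_lifts _).mp hlift
  exact ⟨Q, hQ.symm⟩

/-- **`χ_M ∈ E[X] ⟹ χ_{M^f} ∈ E[X]`, uniformly in `M`.**  For a ring map `e : E → k` into a field,
a polynomial `P ∈ E[X]` and `f ∈ ℕ` there is `Q ∈ E[X]` such that every square matrix `M` over
`k` with `χ_M = P^e` has `χ_{M^f} = Q^e`: over an algebraic closure `k̄`, `P^e = ∏ (X - a)` over
its roots and `χ_{M^f} = ∏ (X - a^f)`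
(`Literature.NumberTheory.Automorphic.Matrix.charpoly_pow_eq_prod_of_charpoly_eq_prod`), which
descends to `E` by `exists_prod_X_sub_C_pow_eq_map`.  Bourbaki, *Algèbre*, Ch. IV §6, no. 1 and
Ch. VII §5, no. 5. [folklore] -/
theorem Matrix.exists_charpoly_pow_eq_map {ι : Type*} [Fintype ι] [DecidableEq ι]
    {k : Type*} [Field k] {E : Type*} [CommRing E] (e : E →+* k) (P : E[X]) (f : ℕ) :
    ∃ Q : E[X], ∀ M : Matrix ι ι k, M.charpoly = P.map e → (M ^ f).charpoly = Q.map e := by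
  classical
  by_cases hmon : (P.map e).Monic
  · let K := AlgebraicClosure k
    let j : k →+* K := algebraMap k K
    set s := ((P.map e).map j).roots with hs
    have hsplit : (s.map fun a => X - C a).prod = (P.map e).map j :=
      prod_multiset_X_sub_C_of_monic_of_roots_card_eq (hmon.map j)
        IsAlgClosed.card_roots_eq_natDegree
    obtain ⟨Q, hQ⟩ := exists_prod_X_sub_C_pow_eq_map (j.comp e) (s := s) (P := P)
      (by rw [← Polynomial.map_map, hsplit]) f
    refine ⟨Q, fun M hM => ?_⟩
    apply Polynomial.map_injective j j.injective
    have hM' : (M.map j).charpoly = (s.map fun a => X - C a).prod := by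
      rw [Matrix.charpoly_map, hM, hsplit]
    rw [← Matrix.charpoly_map, Matrix.map_pow,
      Automorphic.Matrix.charpoly_pow_eq_prod_of_charpoly_eq_prod _ hM' f, hQ, Polynomial.map_map]
  · exact ⟨0, fun M hM => absurd (hM ▸ Matrix.charpoly_monic M) hmon⟩

end Symmetric

/-! ### `E`-rationality under restriction to `Γ_L` -/

section Restrict

variable {K : Type*} [Field K] [NumberField K] (L : Type*) [Field L] [NumberField L]
  [Algebra K L] {k : Type*} [Field k] [TopologicalSpace k] {n : ℕ} {E : Type*} [CommRing E]

/-- **`E`-rationality is stable under restriction** (Böckle–Hui §2.7, first sentence of the proof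
of Thm. 1.1: "For any finite field extension `L/K`, the restriction `ρ_ℓ|_{Gal_L}` is also
`E`-rational").  If `σ : Γ_K →ₜ* GL_n(k)` is `E`-rational with respect to `e : E → k`
(`FramedGaloisRep.IsRationalOver`: at all but finitely many `v`, `σ` is unramified with Frobenius
characteristic polynomial in `e(E[X])`), then so is `σ|_{Γ_L}` for every finite extension `L/K`
of number fields: only finitely many places `w` of `L` lie over the finitely many exceptional `v`
(`finite_setOf_under_eq`); at the others `σ|_{Γ_L}` is unramified
(`FramedGaloisRep.isUnramifiedAt_restrictField`) and an arithmetic Frobenius at `w` acts through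
`Frob_v^{f(w|v)}` (`FramedGaloisRep.exists_restrictField_apply_eq_pow`), whose characteristic
polynomial lies in `e(E[X])` together with that of `Frob_v`
(`Matrix.exists_charpoly_pow_eq_map`).  Serre, *Abelian ℓ-adic representations*, Ch. I §2.3.
[cite: BockleHui2025, §2.7 (proof of Theorem 1.1)] -/
theorem FramedGaloisRep.IsRationalOver.restrictField {e : E →+* k} {σ : FramedGaloisRep K k n}
    (h : σ.IsRationalOver e) : (σ.restrictField L).IsRationalOver e := by
  classical
  have hB : {v : HeightOneSpectrum (𝓞 K) |
      ¬ (σ.IsUnramifiedAt v ∧ ∃ P : E[X], σ.HasFrobCharpolyAt v (P.map e))}.Finite :=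
    Filter.eventually_cofinite.mp h
  have hfin : ((fun w : HeightOneSpectrum (𝓞 L) => w.under (𝓞 K)) ⁻¹'
      {v : HeightOneSpectrum (𝓞 K) |
        ¬ (σ.IsUnramifiedAt v ∧ ∃ P : E[X], σ.HasFrobCharpolyAt v (P.map e))}).Finite :=
    hB.preimage' fun v _ => finite_setOf_under_eq (M := L) v
  rw [FramedGaloisRep.IsRationalOver, Filter.eventually_cofinite]
  refine hfin.subset fun w hw => ?_
  simp only [Set.mem_preimage, Set.mem_setOf_eq] at hw ⊢
  intro hgood
  apply hw
  obtain ⟨hunr, P, hP⟩ := hgood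
  have hwv : w.asIdeal.under (𝓞 K) = (w.under (𝓞 K)).asIdeal := rfl
  refine ⟨σ.isUnramifiedAt_restrictField hwv hunr, ?_⟩
  obtain ⟨Q, hQ⟩ := Matrix.exists_charpoly_pow_eq_map (ι := Fin n) e P
    (w.asIdeal.inertiaDeg (𝓞 K))
  refine ⟨Q, fun 𝔔 h𝔔 τ hτ => ?_⟩
  obtain ⟨𝔓, h𝔓, φ, hφ, heq⟩ := σ.exists_restrictField_apply_eq_pow hwv hunr h𝔔 hτ
  have hch : FramedRep.charpoly σ φ = P.map e := hP 𝔓 h𝔓 φ hφ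
  unfold FramedRep.charpoly at hch ⊢
  rw [heq, Units.val_pow_eq_pow_val]
  exact hQ _ hch

/-- **Böckle–Hui §2.7, first reduction (the Frobenius data survive a finite base change).**  If
`ρ : Γ_K →ₜ* GL_n(k)` is `E`-rational and the character `ψ : Γ_K →ₜ* GL_1(k)` weakly divides `ρ`
(`FramedGaloisRep.WeaklyDivides`, BH Def. 2.3), then for every finite extension `L/K` of number
fields `ρ|_{Γ_L}` is `E`-rational (`IsRationalOver.restrictField`) and `ψ|_{Γ_L}` weakly divides
`ρ|_{Γ_L}` (`WeaklyDivides.restrictField` of `WeakAbelianDirectSummandRestrictProofs`) — the two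
hypotheses of Theorem 1.1 (`exists_heckeCharacter_of_weaklyDivides`) on the Frobenius data are
those of the same statement over `L` ("For any finite field extension `L/K`, the restriction
`ρ_ℓ|_{Gal_L}` is also `E`-rational … we may assume that the algebraic monodromy group `G_ℓ` is
connected by replacing `K` by some finite extension").
[cite: BockleHui2025, §2.7 (proof of Theorem 1.1)] -/
theorem FramedGaloisRep.isRationalOver_and_weaklyDivides_restrictField {e : E →+* k}
    {ρ : FramedGaloisRep K k n} (hρ : ρ.IsRationalOver e) {ψ : FramedGaloisRep K k 1}
    (hψ : ψ.WeaklyDivides ρ) :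
    (ρ.restrictField L).IsRationalOver e ∧
      (ψ.restrictField L).WeaklyDivides (ρ.restrictField L) :=
  ⟨hρ.restrictField L, hψ.restrictField L⟩

end Restrict

end Literature.NumberTheory.GaloisRepresentations
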